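import Summits.ABC.ABC.Theorems.IUTThetaPilotABCOfCor312UnionAbove
import Summits.ABC.IUTFork.LDHGenuineHullRegimeSlackExplicit
import HarnessLib

/-!
# Crux `ThetaPartII` (stmt-ABC-19678, route `IUTThetaPilot`), (U) line: the regime stub CUT DOWN to the data above the
# CLOSED-FORM log-height threshold `Θ_expl(P, l) ≈ 2.2·10⁷·d_mod·l` — explicit-threshold twin of
# `IUTThetaPilotABCOfCor312UnionAbove.lean`

Mochizuki, *Inter-universal Teichmüller theory IV*, RIMS manuscript (Apr. 2020; = PRIMS **57** (2021)), Thm. 1.10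
(pp. 22–31) with its proof Steps (ii)–(viii) (pp. 24–31), Cor. 2.2 (ii) (pp. 41–48), Cor. 2.3 (pp. 49–55); [IUTchIII]
Cor. 3.12 (kurims p. 174).

Record-only, proof-only file (D-0012) of the abc-iut cell (campaign-S seat abc-iut-S3; abc-iut-plan R-g8-7c asked for the
«p427882 form» of the threshold). TAKES NO SIDE on [IUTchIII] Cor. 3.12 or on the reading (U)/(P) of `−|log(Θ)|`. Everything
here is CONDITIONAL on the named hypotheses; nothing is asserted about any point.

`IUTThetaPilotABCOfCor312UnionAbove.lean` (abc-iut-S3, p430416) derives the registered `stub_hullRegime` of the (U) line — and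
with abc-iut-c312-8's capstone, `ABC` — from the binder `habove` demanded only at admissible `(P, l)` with `2 ≤ d_mod` and
`log(q^{∤{2,l}}(λ))` above the threshold of abc-iut-c312-d1's `LDHGenuineHullRegimeSlack.lean`, which contains the prime-counting
function `π(d*·l)`. THIS FILE states the same with abc-iut-c312-d1's CLOSED-FORM threshold of
`LDHGenuineHullRegimeSlackExplicit.lean` (p427882; Chebyshev's `π(N) ≥ N·log 2/(2·log(2N))`, [cite: FellowsKoblitz1992, Lemma 1]):

  `Θ_expl(P, l) := 40·log(d*·l)·((d*·l)·log 2/(2·log(2·d*·l)) − (2·d_mod·(log-diff + log 𝔣^{∤{2,l}}) + log(30·l))/log 2)`,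
  `d* = 2^12·3^3·5·d_mod` — at most `20·log 2·(d*·l)` (abc-iut-c312-d1 `Cor22.explicitThreshold_le`), i.e. `≈ 2.2·10⁷·d_mod·l`.

* `ThetaPartII.hullRegime_of_hullRegimeAboveExplicit` / `ThetaPartII.stubHullRegime_of_aboveExplicit` — the registered regime body
  at one admissible `(P, l)` / in its registered bytes, from the estimate for the non-slot-constant data assumed ONLY WHEN
  `2 ≤ d_mod` AND `Θ_expl(P, l) < log(q^{∤{2,l}}(λ))` (below: `PointDict.hullEstimateOf_BIII_of_logQAvoid_le_explicit`; `d_mod = 1`: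
  void by `PointStepV.slotConstant_of_dmod_eq_one`);
* **`ThetaPartII.ThetaPartII_of_cor312_of_hullRegimeAboveExplicit`, `ThetaPartII.ABC_of_cor312_of_hullRegimeAboveExplicit`** — the
  crux, resp. `ABC`, from `stub_cor312` verbatim and that binder alone (abc-iut-c312-8 `ABC_of_cor312_of_hullRegime`).
Since `Θ_expl ≤` the `π`-threshold, the binder here is (slightly) STRONGER than p430416's `habove`; its merit is the closed form.
So, in reading (U): abc ⟸ {[IUTchIII] Cor. 3.12 as stated at the Θ-data of the `λ`-line, ONE named Szpiro-type binder at genuine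
data of points with `d_mod ≥ 2` and `log(q^{∤{2,l}}) > Θ_expl(P,l)`} — claimed in neither direction (plan VERDICT RISK ¶7).
[cite: Mochizuki2012, IUTchIV Thm. 1.10 proof Steps (ii)–(viii) p. 24–31] [claim: Mochizuki2012, status: disputed] for every
IUT quotation; no side taken.
-/

noncomputable section

set_option linter.dupNamespace false

namespace Summit.ABC.ABC.Theorems.ThetaPartII

open Literature.NumberTheory.DiophantineGeometry.GenEll Literature.IUT.LogVolume Literature.IUT.HodgeTheaters
open Summit.ABC.IUTFork NumberField IsDedekindDomain Literature.NumberTheory.NumberFields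

variable {P : NFPoint} {l : ℕ}

/-- **The registered regime body at ONE admissible `(P, l)` from the hypothesis above the CLOSED-FORM threshold**: for
`λ ∈ U_P` (minimally presented) and `l ≥ 5` prime with (P6): if the (U)-hull estimate with `B_III(P,l)` holds for the
NON-slot-constant genuine data at `(P, l)` PROVIDED `2 ≤ d_mod` AND `Θ_expl(P, l) < log(q^{∤{2,l}}(λ))`, then it holds for ALL
non-slot-constant genuine data at `(P, l)` — below `Θ_expl` by abc-iut-c312-d1's `PointDict.hullEstimateOf_BIII_of_logQAvoid_le_explicit`
([IUTchIV] Thm. 1.10 Step (viii)'s prime-counting slack, Chebyshev's lower bound), at `d_mod = 1` vacuously. CONDITIONAL on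
`habove`; no side taken. [cite: Mochizuki2012, IUTchIV Thm. 1.10 proof Steps (v), (viii) p. 27–31] [claim: Mochizuki2012, status: disputed] -/
theorem hullRegime_of_hullRegimeAboveExplicit (hP : P ∈ UP) (hl : l.Prime) (h5 : 5 ≤ l) (h6 : Cor22.CondP6 P l)
    (habove : 2 ≤ Cor22.dmod P →
      40 * Real.log (((2 ^ 12 * 3 ^ 3 * 5 * Cor22.dmod P : ℕ) : ℝ) * l)
        * ((((2 ^ 12 * 3 ^ 3 * 5 * Cor22.dmod P * l : ℕ) : ℝ)) * Real.log 2
            / (2 * Real.log (2 * (((2 ^ 12 * 3 ^ 3 * 5 * Cor22.dmod P * l : ℕ) : ℝ))))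
          - (2 * (Cor22.dmod P : ℝ) * (P.logDiff + Cor22.logCondAvoid P {2, l}) + Real.log (2 * 3 * 5 * (l : ℝ)))
            / Real.log 2) < Cor22.logQAvoid P {2, l} →
      ∀ T : Cor22.ThetaVolumeDatumAt P l,
        (letI := T.instFieldF; letI := T.instNumberFieldF; letI := T.instAlgebraF; letI := T.instFieldK
         letI := T.instNumberFieldK; letI := T.instAlgebraK; letI := T.instFieldFbar; letI := T.instAlgebraFbar
         letI := T.instAlgebraKFbar; letI := T.instIsElliptic
         ¬ (∀ p ∈ T.I.supportPrimes, ∀ v w : placesOver (fieldOfModuli T.E) p,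
            (Summit.ABC.IUTFork.DHData.ofInput T.I).logQloc p v = (Summit.ABC.IUTFork.DHData.ofInput T.I).logQloc p w)) →
        T.HullEstimateOf
          (((l : ℝ) + 1) / 4 *
            ((1 + 12 * (Cor22.dmod P : ℝ) / l) * (P.logDiff + Cor22.logCondAvoid P {2, l})
              + 2 * Real.log l + 52
              + 20 / 3 * Real.log (((2 ^ 12 * 3 ^ 3 * 5 * Cor22.dmod P : ℕ) : ℝ) * (l : ℝ))
                * (Nat.primeCounting (2 ^ 12 * 3 ^ 3 * 5 * Cor22.dmod P * l) : ℝ)))) :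
      ∀ T : Cor22.ThetaVolumeDatumAt P l,
        (letI := T.instFieldF; letI := T.instNumberFieldF; letI := T.instAlgebraF; letI := T.instFieldK
         letI := T.instNumberFieldK; letI := T.instAlgebraK; letI := T.instFieldFbar; letI := T.instAlgebraFbar
         letI := T.instAlgebraKFbar; letI := T.instIsElliptic
         ¬ (∀ p ∈ T.I.supportPrimes, ∀ v w : placesOver (fieldOfModuli T.E) p,
            (Summit.ABC.IUTFork.DHData.ofInput T.I).logQloc p v = (Summit.ABC.IUTFork.DHData.ofInput T.I).logQloc p w)) →
        T.HullEstimateOf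
          (((l : ℝ) + 1) / 4 *
            ((1 + 12 * (Cor22.dmod P : ℝ) / l) * (P.logDiff + Cor22.logCondAvoid P {2, l})
              + 2 * Real.log l + 52
              + 20 / 3 * Real.log (((2 ^ 12 * 3 ^ 3 * 5 * Cor22.dmod P : ℕ) : ℝ) * (l : ℝ))
                * (Nat.primeCounting (2 ^ 12 * 3 ^ 3 * 5 * Cor22.dmod P * l) : ℝ))) := by
  have h7 : 7 ≤ l := seven_le_of_condP6 hP hl h5 h6
  intro T
  letI := T.instFieldF; letI := T.instNumberFieldF; letI := T.instAlgebraF; letI := T.instFieldK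
  letI := T.instNumberFieldK; letI := T.instAlgebraK; letI := T.instFieldFbar; letI := T.instAlgebraFbar
  letI := T.instAlgebraKFbar; letI := T.instIsElliptic
  intro hnc
  -- below the closed-form threshold: abc-iut-c312-d1's explicit slack theorem (no regime hypothesis at all)
  by_cases hlow : Cor22.logQAvoid P {2, l} ≤
      40 * Real.log (((2 ^ 12 * 3 ^ 3 * 5 * Cor22.dmod P : ℕ) : ℝ) * l)
        * ((((2 ^ 12 * 3 ^ 3 * 5 * Cor22.dmod P * l : ℕ) : ℝ)) * Real.log 2
            / (2 * Real.log (2 * (((2 ^ 12 * 3 ^ 3 * 5 * Cor22.dmod P * l : ℕ) : ℝ))))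
          - (2 * (Cor22.dmod P : ℝ) * (P.logDiff + Cor22.logCondAvoid P {2, l}) + Real.log (2 * 3 * 5 * (l : ℝ)))
            / Real.log 2)
  · exact PointDict.hullEstimateOf_BIII_of_logQAvoid_le_explicit T hP h7 hlow
  -- at `d_mod = 1` every datum is slot-constant: the antecedent is void
  by_cases hd : Cor22.dmod P = 1
  · exact absurd (PointStepV.slotConstant_of_dmod_eq_one T hd) hnc
  -- `d_mod ≥ 2`, above the threshold: the hypothesis
  have hd2 : 2 ≤ Cor22.dmod P := by have := Cor22.dmod_pos P; omega
  exact habove hd2 (lt_of_not_ge hlow) T hnc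

/-- **The registered stub `stub_hullRegime` of the (U) line (its registered bytes) from the binder above the CLOSED-FORM
threshold ALONE** (`hullRegime_of_hullRegimeAboveExplicit` pointwise). CONDITIONAL on `habove`; no side taken.
[cite: Mochizuki2012, IUTchIV Thm. 1.10 proof Steps (v), (viii) p. 27–31] [claim: Mochizuki2012, status: disputed] -/
theorem stubHullRegime_of_aboveExplicit
    (habove : ∀ P : NFPoint, P ∈ UP → ∀ l : ℕ, l.Prime → 5 ≤ l →
      Cor22.AdmitsCore P → Cor22.CondP2 P l → Cor22.CondP5 P l → Cor22.CondP6 P l →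
      2 ≤ Cor22.dmod P →
      40 * Real.log (((2 ^ 12 * 3 ^ 3 * 5 * Cor22.dmod P : ℕ) : ℝ) * l)
        * ((((2 ^ 12 * 3 ^ 3 * 5 * Cor22.dmod P * l : ℕ) : ℝ)) * Real.log 2
            / (2 * Real.log (2 * (((2 ^ 12 * 3 ^ 3 * 5 * Cor22.dmod P * l : ℕ) : ℝ))))
          - (2 * (Cor22.dmod P : ℝ) * (P.logDiff + Cor22.logCondAvoid P {2, l}) + Real.log (2 * 3 * 5 * (l : ℝ)))
            / Real.log 2) < Cor22.logQAvoid P {2, l} →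
      ∀ T : Cor22.ThetaVolumeDatumAt P l,
        (letI := T.instFieldF; letI := T.instNumberFieldF; letI := T.instAlgebraF; letI := T.instFieldK
         letI := T.instNumberFieldK; letI := T.instAlgebraK; letI := T.instFieldFbar; letI := T.instAlgebraFbar
         letI := T.instAlgebraKFbar; letI := T.instIsElliptic
         ¬ (∀ p ∈ T.I.supportPrimes, ∀ v w : placesOver (fieldOfModuli T.E) p,
            (Summit.ABC.IUTFork.DHData.ofInput T.I).logQloc p v = (Summit.ABC.IUTFork.DHData.ofInput T.I).logQloc p w)) →
        T.HullEstimateOf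
          (((l : ℝ) + 1) / 4 *
            ((1 + 12 * (Cor22.dmod P : ℝ) / l) * (P.logDiff + Cor22.logCondAvoid P {2, l})
              + 2 * Real.log l + 52
              + 20 / 3 * Real.log (((2 ^ 12 * 3 ^ 3 * 5 * Cor22.dmod P : ℕ) : ℝ) * (l : ℝ))
                * (Nat.primeCounting (2 ^ 12 * 3 ^ 3 * 5 * Cor22.dmod P * l) : ℝ)))) :
    ∀ P : NFPoint, P ∈ UP → ∀ l : ℕ, l.Prime → 5 ≤ l →
      Cor22.AdmitsCore P → Cor22.CondP2 P l → Cor22.CondP5 P l → Cor22.CondP6 P l →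
      ∀ T : Cor22.ThetaVolumeDatumAt P l,
        (letI := T.instFieldF; letI := T.instNumberFieldF; letI := T.instAlgebraF; letI := T.instFieldK
         letI := T.instNumberFieldK; letI := T.instAlgebraK; letI := T.instFieldFbar; letI := T.instAlgebraFbar
         letI := T.instAlgebraKFbar; letI := T.instIsElliptic
         ¬ (∀ p ∈ T.I.supportPrimes, ∀ v w : placesOver (fieldOfModuli T.E) p,
            (Summit.ABC.IUTFork.DHData.ofInput T.I).logQloc p v = (Summit.ABC.IUTFork.DHData.ofInput T.I).logQloc p w)) →
        T.HullEstimateOf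
          (((l : ℝ) + 1) / 4 *
            ((1 + 12 * (Cor22.dmod P : ℝ) / l) * (P.logDiff + Cor22.logCondAvoid P {2, l})
              + 2 * Real.log l + 52
              + 20 / 3 * Real.log (((2 ^ 12 * 3 ^ 3 * 5 * Cor22.dmod P : ℕ) : ℝ) * (l : ℝ))
                * (Nat.primeCounting (2 ^ 12 * 3 ^ 3 * 5 * Cor22.dmod P * l) : ℝ))) :=
  fun P hP l hl h5 hcore h2 hP5 h6 =>
    hullRegime_of_hullRegimeAboveExplicit hP hl h5 h6 (habove P hP l hl h5 hcore h2 hP5 h6)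

/-- **The crux `ThetaPartII` on the (U) line from `stub_cor312` and the binder above the CLOSED-FORM threshold ALONE**
(via `stubHullRegime_of_aboveExplicit` and abc-iut-c312-8's `ThetaPartII_of_cor312_of_hullRegime`). CONDITIONAL on exactly
these two; the item stays OPEN; no side taken. [cite: Mochizuki2012, IUTchIV Thm. 1.10, Cor. 2.2 (ii) pp.22–48]
[claim: Mochizuki2012, status: disputed] -/
theorem ThetaPartII_of_cor312_of_hullRegimeAboveExplicit
    (h312 : ∀ P : NFPoint, P ∈ UP → ∀ l : ℕ, l.Prime → 5 ≤ l →
      Cor22.AdmitsCore P → Cor22.CondP2 P l → Cor22.CondP5 P l → Cor22.CondP6 P l → Cor22.Cor312AtDatum P l)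
    (habove : ∀ P : NFPoint, P ∈ UP → ∀ l : ℕ, l.Prime → 5 ≤ l →
      Cor22.AdmitsCore P → Cor22.CondP2 P l → Cor22.CondP5 P l → Cor22.CondP6 P l →
      2 ≤ Cor22.dmod P →
      40 * Real.log (((2 ^ 12 * 3 ^ 3 * 5 * Cor22.dmod P : ℕ) : ℝ) * l)
        * ((((2 ^ 12 * 3 ^ 3 * 5 * Cor22.dmod P * l : ℕ) : ℝ)) * Real.log 2
            / (2 * Real.log (2 * (((2 ^ 12 * 3 ^ 3 * 5 * Cor22.dmod P * l : ℕ) : ℝ))))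
          - (2 * (Cor22.dmod P : ℝ) * (P.logDiff + Cor22.logCondAvoid P {2, l}) + Real.log (2 * 3 * 5 * (l : ℝ)))
            / Real.log 2) < Cor22.logQAvoid P {2, l} →
      ∀ T : Cor22.ThetaVolumeDatumAt P l,
        (letI := T.instFieldF; letI := T.instNumberFieldF; letI := T.instAlgebraF; letI := T.instFieldK
         letI := T.instNumberFieldK; letI := T.instAlgebraK; letI := T.instFieldFbar; letI := T.instAlgebraFbar
         letI := T.instAlgebraKFbar; letI := T.instIsElliptic
         ¬ (∀ p ∈ T.I.supportPrimes, ∀ v w : placesOver (fieldOfModuli T.E) p,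
            (Summit.ABC.IUTFork.DHData.ofInput T.I).logQloc p v = (Summit.ABC.IUTFork.DHData.ofInput T.I).logQloc p w)) →
        T.HullEstimateOf
          (((l : ℝ) + 1) / 4 *
            ((1 + 12 * (Cor22.dmod P : ℝ) / l) * (P.logDiff + Cor22.logCondAvoid P {2, l})
              + 2 * Real.log l + 52
              + 20 / 3 * Real.log (((2 ^ 12 * 3 ^ 3 * 5 * Cor22.dmod P : ℕ) : ℝ) * (l : ℝ))
                * (Nat.primeCounting (2 ^ 12 * 3 ^ 3 * 5 * Cor22.dmod P * l) : ℝ)))) :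
    Summit.ABC.ABC.Theses.IUTThetaPilot.ThetaPartII :=
  ThetaPartII_of_cor312_of_hullRegime h312 (stubHullRegime_of_aboveExplicit habove)

/-- **`ABC` on the (U) line from `stub_cor312` and the binder above the CLOSED-FORM threshold ALONE** — in reading (U),
abc ⟸ {[IUTchIII] Cor. 3.12 as stated at the Θ-data of the `λ`-line, ONE named Szpiro-type binder at genuine data of points
with `d_mod ≥ 2` and `log(q^{∤{2,l}}(λ)) > Θ_expl(P, l) ≈ 2.2·10⁷·d_mod·l`}, claimed here in neither direction (plan VERDICT
RISK ¶7); via abc-iut-c312-8's `ABC_of_cor312_of_hullRegime` (`closes` with the PROVED `genEllTwo_holds`, `JInvWlog_proof`).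
CONDITIONAL on exactly these two `Prop`s; nothing asserted; no side taken on the dispute or on the (U)/(P) reading.
[cite: Mochizuki2012, IUTchIV Thm. 1.10, Cor. 2.2 (ii), Cor. 2.3 pp.22–55] [claim: Mochizuki2012, status: disputed] -/
theorem ABC_of_cor312_of_hullRegimeAboveExplicit
    (h312 : ∀ P : NFPoint, P ∈ UP → ∀ l : ℕ, l.Prime → 5 ≤ l →
      Cor22.AdmitsCore P → Cor22.CondP2 P l → Cor22.CondP5 P l → Cor22.CondP6 P l → Cor22.Cor312AtDatum P l)
    (habove : ∀ P : NFPoint, P ∈ UP → ∀ l : ℕ, l.Prime → 5 ≤ l →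
      Cor22.AdmitsCore P → Cor22.CondP2 P l → Cor22.CondP5 P l → Cor22.CondP6 P l →
      2 ≤ Cor22.dmod P →
      40 * Real.log (((2 ^ 12 * 3 ^ 3 * 5 * Cor22.dmod P : ℕ) : ℝ) * l)
        * ((((2 ^ 12 * 3 ^ 3 * 5 * Cor22.dmod P * l : ℕ) : ℝ)) * Real.log 2
            / (2 * Real.log (2 * (((2 ^ 12 * 3 ^ 3 * 5 * Cor22.dmod P * l : ℕ) : ℝ))))
          - (2 * (Cor22.dmod P : ℝ) * (P.logDiff + Cor22.logCondAvoid P {2, l}) + Real.log (2 * 3 * 5 * (l : ℝ)))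
            / Real.log 2) < Cor22.logQAvoid P {2, l} →
      ∀ T : Cor22.ThetaVolumeDatumAt P l,
        (letI := T.instFieldF; letI := T.instNumberFieldF; letI := T.instAlgebraF; letI := T.instFieldK
         letI := T.instNumberFieldK; letI := T.instAlgebraK; letI := T.instFieldFbar; letI := T.instAlgebraFbar
         letI := T.instAlgebraKFbar; letI := T.instIsElliptic
         ¬ (∀ p ∈ T.I.supportPrimes, ∀ v w : placesOver (fieldOfModuli T.E) p,
            (Summit.ABC.IUTFork.DHData.ofInput T.I).logQloc p v = (Summit.ABC.IUTFork.DHData.ofInput T.I).logQloc p w)) →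
        T.HullEstimateOf
          (((l : ℝ) + 1) / 4 *
            ((1 + 12 * (Cor22.dmod P : ℝ) / l) * (P.logDiff + Cor22.logCondAvoid P {2, l})
              + 2 * Real.log l + 52
              + 20 / 3 * Real.log (((2 ^ 12 * 3 ^ 3 * 5 * Cor22.dmod P : ℕ) : ℝ) * (l : ℝ))
                * (Nat.primeCounting (2 ^ 12 * 3 ^ 3 * 5 * Cor22.dmod P * l) : ℝ)))) : _root_.ABC :=
  ABC_of_cor312_of_hullRegime h312 (stubHullRegime_of_aboveExplicit habove)

end Summit.ABC.ABC.Theorems.ThetaPartII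

end
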